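import Literature.Barriers.AtomisticToContinuum.DisorderedHarmonicChainCovariance
import Literature.MathematicalPhysics.KineticTheory.LyapunovFrequencyDomain
import HarnessLib

/-!
# The Casher–Lebowitz transmission formula for the stationary heat current: proof

Companion to `DisorderedHarmonicChainSpectral.lean` and `DisorderedHarmonicChainCovariance.lean`
(barrier catalogue `Literature/Barriers/AtomisticToContinuum/`, sub-problem `FouriersLaw`;
provefact unit of `AjankiHuveneers2011_scaling`). This file DISCHARGES the named facts

* (F1b′) `Dhar2008_rightResponse` — `λ B_{p₁p₁}(0,1)/m_1 = (λ²m_1m_n/π)∫_ℝ ω²|det Z_n(ω)|⁻² dω`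
  (`Dhar2008_rightResponse_holds`), and hence
* (F1b) `CasherLebowitz1971_currentFormula` — the left-bath power on the stationary covariance
  is `(T_L - T_R) · clSpectralConductance m λ` (`CasherLebowitz1971_currentFormula_holds`),

i.e. the classical transmission formula `J = (T_L - T_R)(λ² m_1 m_n/π) ∫_ℝ ω² |det Z_n(ω)|⁻² dω`
for the Casher–Lebowitz chain with arbitrary positive masses (Casher–Lebowitz 1971; Dhar 2008
§3.2 `J = ΔT/(4π)∫𝒯`, §3.4.1 `𝒯_N = 4Γ²|G_{1N}|²`, `|G_{1N}| = 1/|Δ_N|`; Ajanki–Huveneers 2011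
(1.2), (2.5)), at the level of the Lyapunov covariance. All proofs, no new facts; with this the
trust base of `AjankiHuveneers2011_scaling_of_spectral` is {F1a (Gaussian steady state), F2 (the
Ajanki–Huveneers theorem proper)}.

## Proof

By `clCovFlux_eq_mul_clRightResponse` it suffices to compute `B_{p₁p₁}(0,1)`, the `(p_1,p_1)`
entry of `lyapSol A Σ_R` for the drift matrix `A = clDriftMatrix m λ` (Hurwitz,
`isHurwitz_clDriftMatrix`) and the unit-temperature right-bath noise `Σ_R = diag(0 ⊕ 2λm_i[i=n-1])`.
The frequency-domain solution of the Lyapunov equation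
(`IsHurwitz.integral_resolvent_diagonal`, `LyapunovFrequencyDomain.lean`) gives
`2π B_{p₁p₁}(0,1) = ∫_ℝ 2λ m_n |R(ω)_{p₁p_n}|² dω`, `R(ω) = (iω - A)⁻¹`, with the integrand
integrable. The `(p,p)` and `(p,q)` blocks of `R(ω)(iω - A) = 1` give
`V(ω) Z_n(-ω) = iω M` for the momentum block `V` (`resolvent_toBlocks₂₂_mul_clImpedance`; no
division by `ω`), `Z_n` is invertible for every real frequency (`det_clImpedance_ne_zero`:
the imaginary — or, at `ω = 0`, the real — part of `u⋆Z u` puts a node at the bath site, then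
propagation along the chain), `Z_n(-ω) = conj Z_n(ω)` entrywise, and the cofactor identity
`(Z⁻¹)_{1n} = 1/det Z` for the tridiagonal `Z` with off-diagonal `-1`
(`adjugate_zero_last_of_superdiag`) yields `|R(ω)_{p₁p_n}|² = ω² m_1²/|det Z_n(ω)|²`
(`normSq_resolvent_inr_zero_last`). Collecting constants,
`λB_{p₁p₁}(0,1)/m_1 = (λ²m_1m_n/π)∫ω²|det Z_n|⁻²`. As a by-product the transmission integrand
is integrable (`integrable_transmission`), so `clSpectralConductance` carries no Bochner junk for
`n ≥ 1`, `m > 0`, `λ > 0`.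
-/

noncomputable section

open Matrix Complex MeasureTheory Filter Topology
open scoped ComplexConjugate

namespace Literature.Barriers.AtomisticToContinuum.HeatConduction

open Literature.MathematicalPhysics.KineticTheory.HeatConduction

/-! ### Entries of the Dirichlet force matrix above the diagonal -/

section Entries

variable {R : Type*} [CommRing R]

/-- The superdiagonal of `Φ_D` is `-1`. [folklore] -/
theorem clForceMatrix_apply_superdiag {n : ℕ} (a j : Fin n) (h : j.val = a.val + 1) :
    (clForceMatrix n : Matrix (Fin n) (Fin n) R) a j = -1 := by
  have e : (clForceMatrix n : Matrix (Fin n) (Fin n) R) a j =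
      (clForceMatrix n *ᵥ Pi.single j (1 : R)) a := by
    rw [mulVec_single_one]
    rfl
  have hja : j ≠ a := fun h' => by rw [h'] at h; omega
  rw [e, clForceMatrix_mulVec_apply, forceMatrix_mulVec_apply_eq, Pi.single_eq_of_ne hja.symm,
    zero_mul, zero_add, mul_zero, add_zero]
  have h2 : (if h' : a.val + 1 < n then (Pi.single j (1 : R) : Fin n → R) ⟨a.val + 1, h'⟩ - 0
      else 0) = 1 := by
    rw [dif_pos (by omega)]
    have : (⟨a.val + 1, by omega⟩ : Fin n) = j := Fin.ext (by simp [h])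
    rw [this, Pi.single_eq_same, sub_zero]
  have h1 : (if h' : 0 < a.val then 0 - (Pi.single j (1 : R) : Fin n → R) ⟨a.val - 1, by omega⟩
      else 0) = 0 := by
    split_ifs with h'
    · have hne : (⟨a.val - 1, by omega⟩ : Fin n) ≠ j := fun h'' => by
        have := congrArg Fin.val h''
        simp at this
        omega
      rw [Pi.single_eq_of_ne hne, sub_zero]
    · rfl
  rw [h1, h2]
  ring

/-- `Φ_D` vanishes above the superdiagonal. [folklore] -/
theorem clForceMatrix_apply_of_lt {n : ℕ} (a j : Fin n) (h : a.val + 1 < j.val) :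
    (clForceMatrix n : Matrix (Fin n) (Fin n) R) a j = 0 := by
  have e : (clForceMatrix n : Matrix (Fin n) (Fin n) R) a j =
      (clForceMatrix n *ᵥ Pi.single j (1 : R)) a := by
    rw [mulVec_single_one]
    rfl
  have hja : j ≠ a := fun h' => by rw [h'] at h; omega
  rw [e, clForceMatrix_mulVec_apply, forceMatrix_mulVec_apply_eq, Pi.single_eq_of_ne hja.symm,
    zero_mul, zero_add, mul_zero, add_zero]
  have h2 : (if h' : a.val + 1 < n then (Pi.single j (1 : R) : Fin n → R) ⟨a.val + 1, h'⟩ - 0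
      else 0) = 0 := by
    split_ifs with h'
    · have hne : (⟨a.val + 1, h'⟩ : Fin n) ≠ j := fun h'' => by
        have := congrArg Fin.val h''
        simp at this
        omega
      rw [Pi.single_eq_of_ne hne, sub_zero]
    · rfl
  have h1 : (if h' : 0 < a.val then 0 - (Pi.single j (1 : R) : Fin n → R) ⟨a.val - 1, by omega⟩
      else 0) = 0 := by
    split_ifs with h'
    · have hne : (⟨a.val - 1, by omega⟩ : Fin n) ≠ j := fun h'' => by
        have := congrArg Fin.val h''
        simp at this
        omega
      rw [Pi.single_eq_of_ne hne, sub_zero]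
    · rfl
  rw [h1, h2]
  ring

/-- **Cofactor identity for a lower Hessenberg matrix with superdiagonal `-1`**: its adjugate
has entry `(0, last)` equal to `1`, i.e. `(T⁻¹)_{0,last} = 1/det T` (the minor is lower
triangular with diagonal `-1`). This is `|G_{1N}| = 1/|Δ_N|` of Dhar 2008 §3.4.1. [folklore] -/
theorem adjugate_zero_last_of_superdiag {k : ℕ} (T : Matrix (Fin (k + 1)) (Fin (k + 1)) R)
    (hsup : ∀ i j : Fin (k + 1), j.val = i.val + 1 → T i j = -1)
    (hzero : ∀ i j : Fin (k + 1), i.val + 1 < j.val → T i j = 0) :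
    T.adjugate 0 (Fin.last k) = 1 := by
  rw [adjugate_apply, det_succ_row _ (Fin.last k)]
  have hrow : ∀ j, (T.updateRow (Fin.last k) (Pi.single 0 1)) (Fin.last k) j =
      (Pi.single (0 : Fin (k + 1)) (1 : R) : Fin (k + 1) → R) j := fun j => by
    simp [updateRow_self]
  simp_rw [hrow]
  rw [Finset.sum_eq_single (0 : Fin (k + 1))]
  · have hN : (T.updateRow (Fin.last k) (Pi.single 0 1)).submatrix (Fin.last k).succAbove
        (0 : Fin (k + 1)).succAbove = Matrix.of fun i j : Fin k => T (Fin.castSucc i) (Fin.succ j) := by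
      ext i j
      simp only [submatrix_apply, Fin.succAbove_last, Fin.succAbove_zero, of_apply,
        updateRow_ne (Fin.castSucc_lt_last i).ne]
    rw [hN, det_of_lowerTriangular]
    · have hdiag : ∀ i : Fin k,
          (Matrix.of fun i j : Fin k => T (Fin.castSucc i) (Fin.succ j)) i i = -1 := fun i => by
        simp only [of_apply]
        exact hsup _ _ (by simp)
      rw [Finset.prod_congr rfl fun i _ => hdiag i, Finset.prod_const, Finset.card_univ,
        Fintype.card_fin, Pi.single_eq_same, mul_one, Fin.val_last, Fin.val_zero, add_zero,
        ← pow_add, ← two_mul, pow_mul, neg_one_sq, one_pow]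
    · intro i j hij
      simp only [of_apply]
      have hij' : i.val < j.val := hij
      exact hzero _ _ (by simp only [Fin.val_castSucc, Fin.val_succ]; omega)
  · intro j _ hj0
    simp [Pi.single_eq_of_ne hj0]
  · intro h
    exact absurd (Finset.mem_univ _) h

/-- Hence `(T⁻¹)_{0,last} = (det T)⁻¹` over a field. [folklore] -/
theorem inv_zero_last_of_superdiag {K : Type*} [Field K] {k : ℕ}
    (T : Matrix (Fin (k + 1)) (Fin (k + 1)) K)
    (hsup : ∀ i j : Fin (k + 1), j.val = i.val + 1 → T i j = -1)
    (hzero : ∀ i j : Fin (k + 1), i.val + 1 < j.val → T i j = 0) :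
    T⁻¹ 0 (Fin.last k) = (T.det)⁻¹ := by
  rw [Matrix.inv_def, Ring.inverse_eq_inv', Matrix.smul_apply, adjugate_zero_last_of_superdiag T
    hsup hzero, smul_eq_mul, mul_one]

end Entries

/-! ### The impedance matrix: conjugation symmetry and invertibility -/

/-- `Z_n(-ω)` is the entrywise conjugate of `Z_n(ω)`. [folklore] -/
theorem clImpedance_neg {n : ℕ} (m : Fin n → ℝ) (lam ω : ℝ) :
    clImpedance m lam (-ω) = (clImpedance m lam ω).map (starRingEnd ℂ) := by
  ext i j
  have hΦ : (starRingEnd ℂ) ((clForceMatrix n : Matrix (Fin n) (Fin n) ℂ) i j) =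
      (clForceMatrix n : Matrix (Fin n) (Fin n) ℂ) i j := by
    have h := congrFun (congrFun (clForceMatrix_map_ofReal n) i) j
    rw [Matrix.map_apply] at h
    rw [← h, Complex.coe_algebraMap, Complex.conj_ofReal]
  simp only [clImpedance, Matrix.sub_apply, Matrix.map_apply, map_sub, hΦ, diagonal_apply]
  split_ifs
  · rw [← bathMult_ofReal]
    simp only [map_add, map_mul, map_pow, Complex.conj_ofReal, Complex.conj_I]
    push_cast
    ring
  · rw [map_zero]

/-- `det Z_n(-ω)` is the conjugate of `det Z_n(ω)`, so both have the same modulus. [folklore] -/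
theorem normSq_det_clImpedance_neg {n : ℕ} (m : Fin n → ℝ) (lam ω : ℝ) :
    Complex.normSq (clImpedance m lam (-ω)).det = Complex.normSq (clImpedance m lam ω).det := by
  rw [clImpedance_neg, ← RingHom.mapMatrix_apply, ← RingHom.map_det, Complex.normSq_conj]

/-- The quadratic form of the impedance matrix:
`u⋆ Z(ω) u = (u⋆Φ_D u) - ω² ∑ m_i|u_i|² - iωλ ∑ ([i=0]+[i=n-1]) m_i |u_i|²`. [folklore] -/
theorem star_dotProduct_clImpedance_mulVec {n : ℕ} (m : Fin n → ℝ) (lam ω : ℝ) (u : Fin n → ℂ) :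
    star u ⬝ᵥ (clImpedance m lam ω *ᵥ u) =
      star u ⬝ᵥ (clForceMatrix n *ᵥ u) -
        (((ω ^ 2 * ∑ i, m i * Complex.normSq (u i) : ℝ) : ℂ) +
          Complex.I * ((ω * lam * ∑ i, bathMult n i * (m i * Complex.normSq (u i)) : ℝ) : ℂ)) := by
  rw [clImpedance, sub_mulVec, dotProduct_sub]
  congr 1
  simp only [dotProduct, mulVec_diagonal, Pi.star_apply, Complex.star_def]
  push_cast
  rw [Finset.mul_sum, Finset.mul_sum, Finset.mul_sum, ← Finset.sum_add_distrib]
  refine Finset.sum_congr rfl fun i _ => ?_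
  rw [Complex.normSq_eq_conj_mul_self, bathMult_ofReal]
  ring

/-- **The impedance matrix is invertible for every real frequency** (`m > 0`, `λ > 0`): a
kernel vector `u` has `u⋆Z(ω)u = 0`, whose imaginary part (`ω ≠ 0`) or real part (`ω = 0`)
forces `u_0 = 0`, and then `u = 0` by propagation along the chain. [folklore] -/
theorem det_clImpedance_ne_zero {n : ℕ} {m : Fin n → ℝ} (hm : ∀ k, 0 < m k) {lam : ℝ}
    (hlam : 0 < lam) (ω : ℝ) : (clImpedance m lam ω).det ≠ 0 := by
  intro hdet
  obtain ⟨u, hu, hZu⟩ := Matrix.exists_mulVec_eq_zero_iff.mpr hdet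
  -- row equations: `(Φ u)_a - w_a u_a = 0`
  have hrow : ∀ a : Fin n, (clForceMatrix n *ᵥ u) a +
      (-((m a : ℂ) * (ω : ℂ) ^ 2 + Complex.I * ω * lam * m a * bathMult n a)) * u a = 0 := by
    intro a
    have h := congrFun hZu a
    rw [clImpedance, sub_mulVec, Pi.sub_apply, mulVec_diagonal, Pi.zero_apply] at h
    linear_combination h
  have hnode : ¬ (∀ a : Fin n, a.val = 0 → u a = 0) := fun h0 =>
    hu (cl_chain_propagation _ u (fun a _ => hrow a) h0)
  -- the quadratic form vanishes
  have hq : star u ⬝ᵥ (clImpedance m lam ω *ᵥ u) = 0 := by rw [hZu, dotProduct_zero]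
  rw [star_dotProduct_clImpedance_mulVec, star_dotProduct_clForceMatrix_mulVec] at hq
  set bond : ℝ := ∑ k : Fin n, ∑ l : Fin n,
    (if l.val = k.val + 1 then Complex.normSq (u l - u k) else 0) with hbond
  set wall : ℝ := ∑ i, bathMult n i * Complex.normSq (u i) with hwall
  set a : ℝ := ∑ i, m i * Complex.normSq (u i) with ha
  set b : ℝ := ∑ i, bathMult n i * (m i * Complex.normSq (u i)) with hb
  have hre := congrArg Complex.re hq
  have him := congrArg Complex.im hq
  simp only [Complex.sub_re, Complex.ofReal_re, Complex.add_re, Complex.mul_re, Complex.I_re,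
    Complex.I_im, Complex.ofReal_im, zero_mul, one_mul, mul_zero, sub_zero, zero_sub,
    Complex.zero_re, Complex.sub_im, Complex.add_im, Complex.mul_im, Complex.zero_im, add_zero,
    zero_add] at hre him
  -- `hre : bond + wall - ω² a = 0`, `him : -(ω λ b) = 0`
  have hwall_nn : ∀ i, 0 ≤ bathMult n i * Complex.normSq (u i) := fun i =>
    mul_nonneg (bathMult_nonneg n i) (Complex.normSq_nonneg _)
  have hb_nn : ∀ i, 0 ≤ bathMult n i * (m i * Complex.normSq (u i)) := fun i =>
    mul_nonneg (bathMult_nonneg n i) (mul_nonneg (hm i).le (Complex.normSq_nonneg _))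
  have hbond_nn : 0 ≤ bond := Finset.sum_nonneg fun k _ => Finset.sum_nonneg fun l _ => by
    split_ifs
    · exact Complex.normSq_nonneg _
    · exact le_rfl
  apply hnode
  intro i hi
  have h1 := one_le_bathMult i hi
  by_cases hω : ω = 0
  · -- real part: `bond + wall = 0`
    subst hω
    have hwall0 : wall = 0 := by
      have : bond + wall = 0 := by simpa using hre
      linarith [Finset.sum_nonneg fun i (_ : i ∈ Finset.univ) => hwall_nn i]
    have hterm := (Finset.sum_eq_zero_iff_of_nonneg fun i _ => hwall_nn i).mp hwall0 i
      (Finset.mem_univ i)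
    rcases mul_eq_zero.mp hterm with h2 | h2
    · linarith
    · exact Complex.normSq_eq_zero.mp h2
  · -- imaginary part: `b = 0`
    have hb0 : b = 0 := by
      have : ω * lam * b = 0 := by linarith
      rcases mul_eq_zero.mp this with h2 | h2
      · rcases mul_eq_zero.mp h2 with h3 | h3
        · exact absurd h3 hω
        · exact absurd h3 hlam.ne'
      · exact h2
    have hterm := (Finset.sum_eq_zero_iff_of_nonneg fun i _ => hb_nn i).mp hb0 i
      (Finset.mem_univ i)
    rcases mul_eq_zero.mp hterm with h2 | h2
    · linarith
    · rcases mul_eq_zero.mp h2 with h3 | h3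
      · exact absurd h3 (hm i).ne'
      · exact Complex.normSq_eq_zero.mp h3

/-! ### The momentum block of the resolvent of the chain -/

/-- `iω - A` of the chain in block form: `[[iω, -M⁻¹], [Φ_D, iω + λE]]`. [folklore] -/
theorem charLine_clDriftMatrix {n : ℕ} (m : Fin n → ℝ) (lam ω : ℝ) :
    charLine (clDriftMatrix m lam) ω =
      Matrix.fromBlocks ((Complex.I * ω) • (1 : Matrix (Fin n) (Fin n) ℂ))
        (-Matrix.diagonal fun i => ((m i : ℂ))⁻¹) (clForceMatrix n)
        ((Complex.I * ω) • (1 : Matrix (Fin n) (Fin n) ℂ) + frictionMatrix (lam : ℂ) n) := by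
  rw [charLine, clDriftMatrix_map_ofReal, ← fromBlocks_one, fromBlocks_smul, sub_eq_add_neg,
    fromBlocks_neg, fromBlocks_add]
  simp

/-- The momentum–momentum block `V(ω)` of the resolvent satisfies `V(ω) Z_n(-ω) = iω M`:
from `R (iω - A) = 1`, the `(p,p)` and `(p,q)` block equations give `U = (V(iω + λE) - 1) M`
and `V (Φ_D - ω²M + iωλEM) = iωM`. [folklore] -/
theorem resolvent_toBlocks₂₂_mul_clImpedance {n : ℕ} {m : Fin n → ℝ} (hm : ∀ k, 0 < m k)
    {lam : ℝ} (hlam : 0 < lam) (ω : ℝ) :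
    (resolventI (clDriftMatrix m lam) ω).toBlocks₂₂ * clImpedance m lam (-ω) =
      (Complex.I * ω) • Matrix.diagonal fun i => (m i : ℂ) := by
  have hA := isHurwitz_clDriftMatrix hm hlam
  set Rm := resolventI (clDriftMatrix m lam) ω with hRm
  have h1 := hA.resolventI_mul_charLine ω
  rw [← hRm, ← fromBlocks_toBlocks Rm, charLine_clDriftMatrix, fromBlocks_multiply,
    ← fromBlocks_one, fromBlocks_inj] at h1
  obtain ⟨-, -, h21, h22⟩ := h1
  set U := Rm.toBlocks₂₁ with hU
  set V := Rm.toBlocks₂₂ with hV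
  set D : Matrix (Fin n) (Fin n) ℂ := Matrix.diagonal fun i => ((m i : ℂ))⁻¹ with hD
  set Dm : Matrix (Fin n) (Fin n) ℂ := Matrix.diagonal fun i => (m i : ℂ) with hDm
  have hm0 : ∀ i, (m i : ℂ) ≠ 0 := fun i => Complex.ofReal_ne_zero.mpr (hm i).ne'
  have hDDm : D * Dm = 1 := by
    rw [hD, hDm, diagonal_mul_diagonal, ← diagonal_one]
    congr 1
    funext i
    exact inv_mul_cancel₀ (hm0 i)
  set B : Matrix (Fin n) (Fin n) ℂ := (Complex.I * ω) • (1 : Matrix (Fin n) (Fin n) ℂ) +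
    frictionMatrix (lam : ℂ) n with hB
  -- `U = (V B - 1) Dm`
  have hUeq : U = (V * B - 1) * Dm := by
    rw [Matrix.mul_neg] at h22
    have e' : V * B = U * D + 1 := neg_add_eq_iff_eq_add.mp h22
    have e : U * D = V * B - 1 := by rw [e', add_sub_cancel_right]
    calc U = U * D * Dm := by rw [Matrix.mul_assoc, hDDm, Matrix.mul_one]
      _ = (V * B - 1) * Dm := by rw [e]
  -- substitute into the `(p,q)` equation
  have h3 : V * (clForceMatrix n + (Complex.I * ω) • (B * Dm)) = (Complex.I * ω) • Dm := by
    rw [hUeq, Matrix.mul_smul, Matrix.mul_one, sub_mul, Matrix.one_mul, smul_sub] at h21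
    rw [Matrix.mul_add, Matrix.mul_smul, ← Matrix.mul_assoc, ← sub_eq_zero, ← h21]
    abel
  have hZ : clForceMatrix n + (Complex.I * ω) • (B * Dm) = clImpedance m lam (-ω) := by
    rw [hB, add_mul, smul_mul_assoc, Matrix.one_mul, frictionMatrix, hDm, diagonal_mul_diagonal,
      clImpedance, sub_eq_add_neg]
    congr 1
    ext i j
    simp only [Matrix.add_apply, Matrix.smul_apply, Matrix.neg_apply, diagonal_apply, smul_eq_mul]
    split_ifs
    · push_cast
      ring_nf
      rw [Complex.I_sq]
      ring
    · simp
  rw [hZ] at h3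
  exact h3

/-- Off-diagonal entries of the impedance matrix are those of `Φ_D`. [folklore] -/
theorem clImpedance_apply_of_ne {n : ℕ} (m : Fin n → ℝ) (lam ω : ℝ) {i j : Fin n} (h : i ≠ j) :
    clImpedance m lam ω i j = (clForceMatrix n : Matrix (Fin n) (Fin n) ℂ) i j := by
  rw [clImpedance, Matrix.sub_apply, diagonal_apply_ne _ h, sub_zero]

/-- **The transfer entry of the resolvent**:
`|R(ω)_{p₁ p_n}|² = ω² m_1² / |det Z_n(ω)|²` (`G⁺_{1N} = iω m_1 (Z̃⁻¹)_{1N}` and the cofactor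
identity). [folklore] -/
theorem normSq_resolvent_inr_zero_last {k : ℕ} {m : Fin (k + 1) → ℝ} (hm : ∀ i, 0 < m i)
    {lam : ℝ} (hlam : 0 < lam) (ω : ℝ) :
    Complex.normSq (resolventI (clDriftMatrix m lam) ω (Sum.inr 0) (Sum.inr (Fin.last k))) =
      ω ^ 2 * m 0 ^ 2 / Complex.normSq (clImpedance m lam ω).det := by
  have hV := resolvent_toBlocks₂₂_mul_clImpedance hm hlam ω
  have hdet : (clImpedance m lam (-ω)).det ≠ 0 := det_clImpedance_ne_zero hm hlam (-ω)
  have hunit : IsUnit (clImpedance m lam (-ω)).det := isUnit_iff_ne_zero.mpr hdet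
  have hVeq : (resolventI (clDriftMatrix m lam) ω).toBlocks₂₂ =
      ((Complex.I * ω) • Matrix.diagonal fun i => (m i : ℂ)) * (clImpedance m lam (-ω))⁻¹ := by
    rw [← hV, Matrix.mul_nonsing_inv_cancel_right _ _ hunit]
  have hsup : ∀ i j : Fin (k + 1), j.val = i.val + 1 → clImpedance m lam (-ω) i j = -1 := by
    intro i j hij
    rw [clImpedance_apply_of_ne _ _ _ (fun h => by rw [h] at hij; omega)]
    exact clForceMatrix_apply_superdiag i j hij
  have hzero : ∀ i j : Fin (k + 1), i.val + 1 < j.val → clImpedance m lam (-ω) i j = 0 := by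
    intro i j hij
    rw [clImpedance_apply_of_ne _ _ _ (fun h => by rw [h] at hij; omega)]
    exact clForceMatrix_apply_of_lt i j hij
  have hentry : resolventI (clDriftMatrix m lam) ω (Sum.inr 0) (Sum.inr (Fin.last k)) =
      Complex.I * ω * m 0 * ((clImpedance m lam (-ω)).det)⁻¹ := by
    have e : resolventI (clDriftMatrix m lam) ω (Sum.inr 0) (Sum.inr (Fin.last k)) =
        (resolventI (clDriftMatrix m lam) ω).toBlocks₂₂ 0 (Fin.last k) := rfl
    rw [e, hVeq, smul_mul_assoc, Matrix.smul_apply, diagonal_mul,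
      inv_zero_last_of_superdiag _ hsup hzero, smul_eq_mul]
    ring
  rw [hentry, Complex.normSq_mul, Complex.normSq_mul, Complex.normSq_mul, Complex.normSq_inv,
    normSq_det_clImpedance_neg, Complex.normSq_I, Complex.normSq_ofReal, Complex.normSq_ofReal]
  ring

end Literature.Barriers.AtomisticToContinuum.HeatConduction

namespace Literature.Barriers.AtomisticToContinuum

open Literature.MathematicalPhysics.KineticTheory.HeatConduction HeatConduction

/-- **(F1b′) discharged: the frequency representation of the right-bath response.**
`λ B_{p₁p₁}(0,1)/m_1 = (λ² m_1 m_n/π) ∫_ℝ ω² |det Z_n(ω)|^{-2} dω`: the `(p₁,p₁)` entry of the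
Lyapunov solution for the unit-temperature right bath is `(1/2π)∫ 2λm_n |R(ω)_{p₁p_n}|² dω`
(`IsHurwitz.integral_resolvent_diagonal`), and `|R(ω)_{p₁p_n}|² = ω²m_1²/|det Z_n(ω)|²`.
[cite: Dhar2008, §3.2 (formula for `K`) and §3.4.1] -/
theorem Dhar2008_rightResponse_holds : Dhar2008_rightResponse := by
  intro n m hm lam hlam
  cases n with
  | zero =>
    simp [clRightResponse, clSpectralConductance]
  | succ k =>
    have hA := isHurwitz_clDriftMatrix hm hlam
    -- the left-hand side has the single term of site `0`
    have hL : clRightResponse m lam = lam * clCov m lam 0 1 (Sum.inr 0) (Sum.inr 0) / m 0 := by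
      unfold clRightResponse
      rw [Fin.sum_univ_succ]
      simp
    -- the noise matrix of the unit-temperature right bath as a diagonal
    set d : Fin (k + 1) ⊕ Fin (k + 1) → ℝ :=
      Sum.elim 0 (fun i => 2 * lam * m i * bathTemp (k + 1) 0 1 i) with hd_def
    have hSig : clNoiseMatrix m lam 0 1 = Matrix.diagonal d := by
      ext a b
      rcases a with i | i <;> rcases b with j | j <;>
        simp [clNoiseMatrix, hd_def, diagonal_apply]
    have hbt : ∀ i : Fin (k + 1), bathTemp (k + 1) (0 : ℝ) 1 i = if i = Fin.last k then 1 else 0 := by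
      intro i
      simp only [bathTemp, ite_self, zero_add, Nat.add_sub_cancel]
      by_cases h : i = Fin.last k
      · rw [if_pos h, if_pos (by rw [h]; rfl)]
      · rw [if_neg h, if_neg (fun h' => h (Fin.ext (by simpa using h')))]
    have hd : ∀ l, 0 ≤ d l := by
      rintro (i | i)
      · simp [hd_def]
      · simp only [hd_def, Sum.elim_inr, hbt]
        split_ifs
        · have := hm i
          positivity
        · simp
    obtain ⟨hint, hval⟩ := hA.integral_resolvent_diagonal d hd (Sum.inr 0)
    have hcov : clCov m lam 0 1 = lyapSol (clDriftMatrix m lam) (Matrix.diagonal d) := by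
      rw [clCov, hSig]
    -- the diagonal spectral density of `p₁` is `2λm_n |R_{p₁p_n}|² = 2λ m_n m_1² ω²/|det Z|²`
    have hpt : ∀ ω : ℝ, ∑ l, d l * Complex.normSq (resolventI (clDriftMatrix m lam) ω (Sum.inr 0) l) =
        2 * lam * m (Fin.last k) * m 0 ^ 2 *
          (ω ^ 2 / Complex.normSq (clImpedance m lam ω).det) := by
      intro ω
      rw [Fintype.sum_sum_type]
      simp only [hd_def, Sum.elim_inl, Pi.zero_apply, zero_mul, Finset.sum_const_zero, zero_add,
        Sum.elim_inr, hbt]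
      rw [Finset.sum_eq_single (Fin.last k)]
      · rw [if_pos rfl, mul_one, normSq_resolvent_inr_zero_last hm hlam ω]
        have hne : Complex.normSq (clImpedance m lam ω).det ≠ 0 :=
          (Complex.normSq_pos.mpr (det_clImpedance_ne_zero hm hlam ω)).ne'
        field_simp
      · intro i _ hi
        rw [if_neg hi]
        simp
      · intro h
        exact absurd (Finset.mem_univ _) h
    simp_rw [hpt] at hint hval
    rw [integral_const_mul] at hval
    -- conclude
    rw [hL, hcov]
    change lam * lyapSol (clDriftMatrix m lam) (Matrix.diagonal d) (Sum.inr 0) (Sum.inr 0) / m 0 =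
      lam ^ 2 * m 0 * m (Fin.last k) / Real.pi *
        ∫ ω : ℝ, ω ^ 2 / Complex.normSq (clImpedance m lam ω).det
    have hπ : Real.pi ≠ 0 := Real.pi_ne_zero
    have hm0 : m 0 ≠ 0 := (hm 0).ne'
    have hX : lyapSol (clDriftMatrix m lam) (Matrix.diagonal d) (Sum.inr 0) (Sum.inr 0) =
        2 * lam * m (Fin.last k) * m 0 ^ 2 *
          (∫ ω : ℝ, ω ^ 2 / Complex.normSq (clImpedance m lam ω).det) / (2 * Real.pi) := by
      rw [eq_div_iff (by positivity), mul_comm, ← hval]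
    rw [hX]
    field_simp

/-- **(F1b) discharged: the Casher–Lebowitz transmission formula for the stationary current.**
[cite: Dhar2008, §3.2 and §3.4.1] [cite: CasherLebowitz1971, transmission formula as restated in AjankiHuveneers2011 eqs. (1.2), (2.5)] -/
theorem CasherLebowitz1971_currentFormula_holds : CasherLebowitz1971_currentFormula :=
  CasherLebowitz1971_currentFormula_of_rightResponse Dhar2008_rightResponse_holds

/-- The transmission integrand is integrable on `ℝ` (positive masses, `λ > 0`, `n ≥ 1`), so
`clSpectralConductance` carries no Bochner junk in the range of the facts. [folklore] -/
theorem integrable_transmission {k : ℕ} {m : Fin (k + 1) → ℝ} (hm : ∀ i, 0 < m i) {lam : ℝ}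
    (hlam : 0 < lam) :
    Integrable fun ω : ℝ => ω ^ 2 / Complex.normSq (clImpedance m lam ω).det := by
  have hA := isHurwitz_clDriftMatrix hm hlam
  set d : Fin (k + 1) ⊕ Fin (k + 1) → ℝ :=
    Sum.elim 0 (fun i => 2 * lam * m i * bathTemp (k + 1) 0 1 i) with hd_def
  have hbt : ∀ i : Fin (k + 1), bathTemp (k + 1) (0 : ℝ) 1 i = if i = Fin.last k then 1 else 0 := by
    intro i
    simp only [bathTemp, ite_self, zero_add, Nat.add_sub_cancel]
    by_cases h : i = Fin.last k
    · rw [if_pos h, if_pos (by rw [h]; rfl)]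
    · rw [if_neg h, if_neg (fun h' => h (Fin.ext (by simpa using h')))]
  have hd : ∀ l, 0 ≤ d l := by
    rintro (i | i)
    · simp [hd_def]
    · simp only [hd_def, Sum.elim_inr, hbt]
      split_ifs
      · have := hm i
        positivity
      · simp
  obtain ⟨hint, -⟩ := hA.integral_resolvent_diagonal d hd (Sum.inr 0)
  have hpt : ∀ ω : ℝ, ∑ l, d l * Complex.normSq (resolventI (clDriftMatrix m lam) ω (Sum.inr 0) l) =
      2 * lam * m (Fin.last k) * m 0 ^ 2 *
        (ω ^ 2 / Complex.normSq (clImpedance m lam ω).det) := by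
    intro ω
    rw [Fintype.sum_sum_type]
    simp only [hd_def, Sum.elim_inl, Pi.zero_apply, zero_mul, Finset.sum_const_zero, zero_add,
      Sum.elim_inr, hbt]
    rw [Finset.sum_eq_single (Fin.last k)]
    · rw [if_pos rfl, mul_one, normSq_resolvent_inr_zero_last hm hlam ω]
      have hne : Complex.normSq (clImpedance m lam ω).det ≠ 0 :=
        (Complex.normSq_pos.mpr (det_clImpedance_ne_zero hm hlam ω)).ne'
      field_simp
    · intro i _ hi
      rw [if_neg hi]
      simp
    · intro h
      exact absurd (Finset.mem_univ _) h
  simp_rw [hpt] at hint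
  have hc : (2 * lam * m (Fin.last k) * m 0 ^ 2) ≠ 0 := by
    have := hm (Fin.last k)
    have := hm 0
    positivity
  exact (integrable_const_mul_iff (isUnit_iff_ne_zero.mpr hc) _).mp hint

end Literature.Barriers.AtomisticToContinuum

end
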